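/-
Copyright (c) 2026. Released under Apache 2.0 license.
-/
import Literature.NumberTheory.Automorphic.UnboundedDenominatorsInvariantHomTransferStep
import Mathlib.GroupTheory.Commutator.Basic
import HarnessLib

/-!
# The layer `Γ(p)/Γ(p²) ≅ 𝔰𝔩₂(𝔽_p)`: coordinates

For the `p`-adic core of the invariant form of CDT Cor. 4.5.3 (levels with `p² ∣ N`) one works in the layer
`V = Γ(p)/Γ(p²)`, which `x = 1 + pX ↦ X mod p` identifies with the trace-zero matrices `𝔰𝔩₂(𝔽_p)`.  This file
packages the three coordinates `((x₀₀-1)/p, x₀₁/p, x₁₀/p) mod p` as a homomorphism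
`Φ : Γ(p) → (ℤ/p)³` (`exists_layerCoord`) together with everything the layer arguments use: `Φ` kills exactly
`Γ(p²)`, the effect of conjugation by `T` (`Ad(T)` on `𝔰𝔩₂`), the values on `T^p`, `S T^p S⁻¹` (the classes
`E`, `-F`), and the resulting normal form of an element of `Γ(p)` modulo `Γ(p²)` in terms of three elements with
the coordinates of `E`, `-F`, `E - F - H`.  Also: `[Γ(a), Γ(b)] ⊆ Γ(ab)` in general
(`commutatorElement_mem_Gamma_mul_of_mem`).

[cite: CalegariDimitrovTang2025, §4.5] [cite: Beyl1986, Theorem]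
-/

open scoped MatrixGroups commutatorElement

namespace Literature.NumberTheory.Automorphic

namespace UnboundedDenominators

open CongruenceSubgroup Matrix.SpecialLinearGroup ModularGroup

/-- **`[Γ(a), Γ(b)] ⊆ Γ(ab)`**: modulo `ab` the reductions `1 + aA`, `1 + bB` commute.
[folklore] [cite: CalegariDimitrovTang2025, §4.5] -/
theorem commutatorElement_mem_Gamma_mul_of_mem {a b : ℕ} {x y : SL(2, ℤ)} (hx : x ∈ Gamma a)
    (hy : y ∈ Gamma b) : ⁅x, y⁆ ∈ Gamma (a * b) := by
  obtain ⟨A, hA⟩ := exists_eq_one_add_smul_of_mem_Gamma hx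
  obtain ⟨B, hB⟩ := exists_eq_one_add_smul_of_mem_Gamma hy
  set f := Int.castRingHom (ZMod (a * b)) with hf
  have hvan : ∀ z : ℤ, f ((a : ℤ) * b * z) = 0 := fun z ↦
    (ZMod.intCast_zmod_eq_zero_iff_dvd _ _).mpr ⟨z, by push_cast; ring⟩
  have hCD : f.mapMatrix ((a : ℤ) • A) * f.mapMatrix ((b : ℤ) • B) = 0 := by
    rw [← map_mul, Matrix.smul_mul, Matrix.mul_smul, smul_smul]
    ext i j
    simp only [RingHom.mapMatrix_apply, Matrix.map_apply, Matrix.smul_apply, smul_eq_mul,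
      Matrix.zero_apply]
    exact hvan _
  have hDC : f.mapMatrix ((b : ℤ) • B) * f.mapMatrix ((a : ℤ) • A) = 0 := by
    rw [← map_mul, Matrix.smul_mul, Matrix.mul_smul, smul_smul, mul_comm (b : ℤ)]
    ext i j
    simp only [RingHom.mapMatrix_apply, Matrix.map_apply, Matrix.smul_apply, smul_eq_mul,
      Matrix.zero_apply]
    exact hvan _
  have hcomm : Commute (Matrix.SpecialLinearGroup.map f x) (Matrix.SpecialLinearGroup.map f y) := by
    rw [commute_iff_eq]
    apply Subtype.ext
    change f.mapMatrix (x : Matrix (Fin 2) (Fin 2) ℤ) * f.mapMatrix (y : Matrix (Fin 2) (Fin 2) ℤ) =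
      f.mapMatrix (y : Matrix (Fin 2) (Fin 2) ℤ) * f.mapMatrix (x : Matrix (Fin 2) (Fin 2) ℤ)
    rw [hA, hB]
    simp only [map_add, map_one, add_mul, mul_add, one_mul, mul_one, hCD, hDC, add_zero]
    abel
  rw [Gamma_mem', map_commutatorElement]
  exact hcomm.commutator_eq

/-- Entries of an element of `Γ(M)`: `x = 1 + M X` with `X` integral. [folklore] -/
private theorem exists_entries_eq' {M : ℕ} {x : SL(2, ℤ)} (hx : x ∈ Gamma M) :
    ∃ α β κ δ : ℤ, (x 0 0 : ℤ) = 1 + M * α ∧ (x 0 1 : ℤ) = M * β ∧ (x 1 0 : ℤ) = M * κ ∧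
      (x 1 1 : ℤ) = 1 + M * δ := by
  obtain ⟨h00, h01, h10, h11⟩ := Gamma_mem.mp hx
  obtain ⟨α, hα⟩ := (ZMod.intCast_eq_intCast_iff_dvd_sub 1 (x 0 0) M).mp (by simpa using h00.symm)
  obtain ⟨β, hβ⟩ := (ZMod.intCast_zmod_eq_zero_iff_dvd _ M).mp h01
  obtain ⟨κ, hκ⟩ := (ZMod.intCast_zmod_eq_zero_iff_dvd _ M).mp h10
  obtain ⟨δ, hδ⟩ := (ZMod.intCast_eq_intCast_iff_dvd_sub 1 (x 1 1) M).mp (by simpa using h11.symm)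
  exact ⟨α, β, κ, δ, by linear_combination hα, hβ, hκ, by linear_combination hδ⟩

/-- The trace condition: for `x = 1 + M X ∈ SL₂(ℤ)`, `tr X = -M det X`. [folklore] -/
private theorem trace_eq' {M : ℕ} (hM : (M : ℤ) ≠ 0) (x : SL(2, ℤ)) (α β κ δ : ℤ)
    (ha : (x 0 0 : ℤ) = 1 + M * α) (hb : (x 0 1 : ℤ) = M * β) (hc : (x 1 0 : ℤ) = M * κ)
    (hd : (x 1 1 : ℤ) = 1 + M * δ) : α + δ = -(M * (α * δ - β * κ)) := by
  have hdet := det_coe x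
  rw [Matrix.det_fin_two, ha, hb, hc, hd] at hdet
  have h1 : (M : ℤ) * (α + δ + M * (α * δ - β * κ)) = 0 := by linear_combination hdet
  have h2 := (mul_eq_zero.mp h1).resolve_left hM
  linear_combination h2

/-- Membership in `Γ(p²)` from entries `1 + p²(…)`. [folklore] -/
private theorem mem_Gamma_sq_of_entries {p : ℕ} {x : SL(2, ℤ)} (α β κ δ : ℤ)
    (ha : (x 0 0 : ℤ) = 1 + p * α) (hb : (x 0 1 : ℤ) = p * β) (hc : (x 1 0 : ℤ) = p * κ)
    (hd : (x 1 1 : ℤ) = 1 + p * δ) (hα : (p : ℤ) ∣ α) (hβ : (p : ℤ) ∣ β) (hκ : (p : ℤ) ∣ κ)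
    (hδ : (p : ℤ) ∣ δ) : x ∈ Gamma (p ^ 2) := by
  obtain ⟨α', rfl⟩ := hα
  obtain ⟨β', rfl⟩ := hβ
  obtain ⟨κ', rfl⟩ := hκ
  obtain ⟨δ', rfl⟩ := hδ
  have hv : ∀ z : ℤ, (((p : ℤ) * (p * z) : ℤ) : ZMod (p ^ 2)) = 0 := fun z ↦
    (ZMod.intCast_zmod_eq_zero_iff_dvd _ _).mpr ⟨z, by push_cast; ring⟩
  rw [Gamma_mem]
  refine ⟨?_, ?_, ?_, ?_⟩
  · rw [ha, Int.cast_add, Int.cast_one, hv, add_zero]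
  · rw [hb, hv]
  · rw [hc, hv]
  · rw [hd, Int.cast_add, Int.cast_one, hv, add_zero]

/-- **Coordinates of the layer `Γ(p)/Γ(p²)`.**  For `p ≠ 0` there is a homomorphism
`Φ : Γ(p) → (ℤ/p)³`, `Φ(1 + pX) = (X₀₀, X₀₁, X₁₀) mod p`, such that: `Φ` kills `Γ(p²)` and conversely
`Φ(x) = 1 ⟹ x ∈ Γ(p²)`; `Φ(T x T⁻¹) = (α+κ, β-2α-κ, κ)` if `Φ(x) = (α, β, κ)` (the action of `Ad(T)` on
`𝔰𝔩₂(𝔽_p)`); `Φ(T^p) = (0,1,0)` and `Φ(S T^p S⁻¹) = (0,0,-1)` (the classes `E` and `-F`); and every `x ∈ Γ(p)`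
is `u_H^i u_E^j u_F^k` modulo `Γ(p²)` for any three elements with the coordinates `(-1,1,-1)`, `(0,1,0)`,
`(0,0,-1)` of `E-F-H`, `E`, `-F`. [cite: CalegariDimitrovTang2025, §4.5] [cite: Beyl1986, Theorem] -/
theorem exists_layerCoord (p : ℕ) (hp : p ≠ 0) :
    ∃ Φ : Gamma p →* Multiplicative (ZMod p × ZMod p × ZMod p),
      (∀ (x : SL(2, ℤ)) (hx : x ∈ Gamma p) (α β κ : ℤ), (x 0 0 : ℤ) = 1 + p * α → (x 0 1 : ℤ) = p * β →
        (x 1 0 : ℤ) = p * κ → Φ ⟨x, hx⟩ = Multiplicative.ofAdd ((α : ZMod p), (β : ZMod p), (κ : ZMod p))) ∧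
      (∀ (x : SL(2, ℤ)) (hx : x ∈ Gamma p), x ∈ Gamma (p ^ 2) → Φ ⟨x, hx⟩ = 1) ∧
      (∀ (x : SL(2, ℤ)) (hx : x ∈ Gamma p), Φ ⟨x, hx⟩ = 1 → x ∈ Gamma (p ^ 2)) ∧
      (∀ (x : SL(2, ℤ)) (hx : x ∈ Gamma p) (hTx : T * x * T⁻¹ ∈ Gamma p) (α β κ : ZMod p),
        Φ ⟨x, hx⟩ = Multiplicative.ofAdd (α, β, κ) →
        Φ ⟨T * x * T⁻¹, hTx⟩ = Multiplicative.ofAdd (α + κ, β - 2 * α - κ, κ)) ∧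
      (∀ hT : T ^ p ∈ Gamma p, Φ ⟨T ^ p, hT⟩ = Multiplicative.ofAdd (0, 1, 0)) ∧
      (∀ hF : S * T ^ p * S⁻¹ ∈ Gamma p, Φ ⟨S * T ^ p * S⁻¹, hF⟩ = Multiplicative.ofAdd (0, 0, -1)) ∧
      (∀ (uH uE uF : SL(2, ℤ)) (hH : uH ∈ Gamma p) (hE : uE ∈ Gamma p) (hF : uF ∈ Gamma p),
        Φ ⟨uH, hH⟩ = Multiplicative.ofAdd (-1, 1, -1) → Φ ⟨uE, hE⟩ = Multiplicative.ofAdd (0, 1, 0) →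
        Φ ⟨uF, hF⟩ = Multiplicative.ofAdd (0, 0, -1) →
        ∀ (x : SL(2, ℤ)), x ∈ Gamma p →
          ∃ i j k : ℤ, x * (uH ^ i * uE ^ j * uF ^ k)⁻¹ ∈ Gamma (p ^ 2)) := by
  have hp' : (p : ℤ) ≠ 0 := by exact_mod_cast hp
  have hpp : (p : ZMod p) = 0 := ZMod.natCast_self p
  -- the function
  let F : Gamma p → ZMod p × ZMod p × ZMod p := fun γ ↦
    (((((γ : SL(2, ℤ)) 0 0 - 1) / p : ℤ) : ZMod p), ((((γ : SL(2, ℤ)) 0 1) / p : ℤ) : ZMod p),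
      ((((γ : SL(2, ℤ)) 1 0) / p : ℤ) : ZMod p))
  have hF : ∀ (γ : Gamma p) (α β κ : ℤ), ((γ : SL(2, ℤ)) 0 0 : ℤ) = 1 + p * α →
      ((γ : SL(2, ℤ)) 0 1 : ℤ) = p * β → ((γ : SL(2, ℤ)) 1 0 : ℤ) = p * κ →
      F γ = ((α : ZMod p), (β : ZMod p), (κ : ZMod p)) := by
    intro γ α β κ ha hb hc
    simp only [F]
    rw [ha, hb, hc, add_sub_cancel_left, Int.mul_ediv_cancel_left _ hp', Int.mul_ediv_cancel_left _ hp',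
      Int.mul_ediv_cancel_left _ hp']
  -- multiplicativity
  have hmul : ∀ γ γ' : Gamma p, F (γ * γ') = F γ + F γ' := by
    intro γ γ'
    obtain ⟨α, β, κ, δ, ha, hb, hc, hd⟩ := exists_entries_eq' γ.2
    obtain ⟨α', β', κ', δ', ha', hb', hc', hd'⟩ := exists_entries_eq' γ'.2
    have e00 : (((γ * γ' : Gamma p) : SL(2, ℤ)) 0 0 : ℤ) = 1 + p * (α + α' + p * (α * α' + β * κ')) := by
      have : (((γ * γ' : Gamma p) : SL(2, ℤ)) 0 0 : ℤ) = (γ : SL(2, ℤ)) 0 0 * (γ' : SL(2, ℤ)) 0 0 +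
          (γ : SL(2, ℤ)) 0 1 * (γ' : SL(2, ℤ)) 1 0 := by
        simp [Matrix.mul_apply, Fin.sum_univ_two]
      rw [this, ha, hb, ha', hc']; ring
    have e01 : (((γ * γ' : Gamma p) : SL(2, ℤ)) 0 1 : ℤ) = p * (β + β' + p * (α * β' + β * δ')) := by
      have : (((γ * γ' : Gamma p) : SL(2, ℤ)) 0 1 : ℤ) = (γ : SL(2, ℤ)) 0 0 * (γ' : SL(2, ℤ)) 0 1 +
          (γ : SL(2, ℤ)) 0 1 * (γ' : SL(2, ℤ)) 1 1 := by
        simp [Matrix.mul_apply, Fin.sum_univ_two]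
      rw [this, ha, hb, hb', hd']; ring
    have e10 : (((γ * γ' : Gamma p) : SL(2, ℤ)) 1 0 : ℤ) = p * (κ + κ' + p * (κ * α' + δ * κ')) := by
      have : (((γ * γ' : Gamma p) : SL(2, ℤ)) 1 0 : ℤ) = (γ : SL(2, ℤ)) 1 0 * (γ' : SL(2, ℤ)) 0 0 +
          (γ : SL(2, ℤ)) 1 1 * (γ' : SL(2, ℤ)) 1 0 := by
        simp [Matrix.mul_apply, Fin.sum_univ_two]
      rw [this, hc, hd, ha', hc']; ring
    rw [hF _ _ _ _ e00 e01 e10, hF γ α β κ ha hb hc, hF γ' α' β' κ' ha' hb' hc', Prod.mk_add_mk,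
      Prod.mk_add_mk, Int.cast_add, Int.cast_add, Int.cast_mul, Int.cast_natCast, hpp, zero_mul, add_zero,
      Int.cast_add, Int.cast_add, Int.cast_mul, Int.cast_natCast, hpp, zero_mul, add_zero,
      Int.cast_add, Int.cast_add, Int.cast_mul, Int.cast_natCast, hpp, zero_mul, add_zero]
  have hone : F 1 = 0 := by
    rw [hF 1 0 0 0 (by simp) (by simp) (by simp)]
    push_cast
    rfl
  let Φ : Gamma p →* Multiplicative (ZMod p × ZMod p × ZMod p) :=
    { toFun := fun γ ↦ Multiplicative.ofAdd (F γ)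
      map_one' := by rw [hone, ofAdd_zero]
      map_mul' := fun a b ↦ by rw [hmul, ofAdd_add] }
  have hΦ : ∀ γ, Φ γ = Multiplicative.ofAdd (F γ) := fun γ ↦ rfl
  -- (1) evaluation
  have P1 : ∀ (x : SL(2, ℤ)) (hx : x ∈ Gamma p) (α β κ : ℤ), (x 0 0 : ℤ) = 1 + p * α →
      (x 0 1 : ℤ) = p * β → (x 1 0 : ℤ) = p * κ →
      Φ ⟨x, hx⟩ = Multiplicative.ofAdd ((α : ZMod p), (β : ZMod p), (κ : ZMod p)) := by
    intro x hx α β κ ha hb hc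
    rw [hΦ, hF ⟨x, hx⟩ α β κ ha hb hc]
  -- (2) kills `Γ(p²)`
  have P2 : ∀ (x : SL(2, ℤ)) (hx : x ∈ Gamma p), x ∈ Gamma (p ^ 2) → Φ ⟨x, hx⟩ = 1 := by
    intro x hx hx2
    obtain ⟨α, β, κ, δ, ha, hb, hc, hd⟩ := exists_entries_eq' hx2
    rw [P1 x hx (p * α) (p * β) (p * κ) (by rw [ha]; push_cast; ring) (by rw [hb]; push_cast; ring)
      (by rw [hc]; push_cast; ring)]
    push_cast
    rw [hpp, zero_mul, zero_mul, zero_mul]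
    rfl
  -- (3) kernel
  have P3 : ∀ (x : SL(2, ℤ)) (hx : x ∈ Gamma p), Φ ⟨x, hx⟩ = 1 → x ∈ Gamma (p ^ 2) := by
    intro x hx h1
    obtain ⟨α, β, κ, δ, ha, hb, hc, hd⟩ := exists_entries_eq' hx
    rw [P1 x hx α β κ ha hb hc] at h1
    have h2 : ((α : ZMod p), (β : ZMod p), (κ : ZMod p)) = 0 := by
      rw [← ofAdd_zero] at h1
      exact Multiplicative.ofAdd.injective h1
    simp only [Prod.mk_eq_zero, ZMod.intCast_zmod_eq_zero_iff_dvd] at h2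
    obtain ⟨hα, hβ, hκ⟩ := h2
    have htr := trace_eq' hp' x α β κ δ ha hb hc hd
    have hδ : (p : ℤ) ∣ δ := by
      have : δ = -(p * (α * δ - β * κ)) - α := by linear_combination htr
      rw [this]
      exact dvd_sub (dvd_neg.mpr (dvd_mul_right _ _)) hα
    exact mem_Gamma_sq_of_entries α β κ δ ha hb hc hd hα hβ hκ hδ
  -- (4) conjugation by `T`
  have P4 : ∀ (x : SL(2, ℤ)) (hx : x ∈ Gamma p) (hTx : T * x * T⁻¹ ∈ Gamma p) (α β κ : ZMod p),
      Φ ⟨x, hx⟩ = Multiplicative.ofAdd (α, β, κ) →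
      Φ ⟨T * x * T⁻¹, hTx⟩ = Multiplicative.ofAdd (α + κ, β - 2 * α - κ, κ) := by
    intro x hx hTx α β κ h
    obtain ⟨a, b, c, d, ha, hb, hc, hd⟩ := exists_entries_eq' hx
    rw [P1 x hx a b c ha hb hc] at h
    have h' : ((a : ZMod p), (b : ZMod p), (c : ZMod p)) = (α, β, κ) := Multiplicative.ofAdd.injective h
    simp only [Prod.mk.injEq] at h'
    obtain ⟨rfl, rfl, rfl⟩ := h'
    have htr := trace_eq' hp' x a b c d ha hb hc hd
    -- entries of `T x T⁻¹`
    have t00 : (T : Matrix (Fin 2) (Fin 2) ℤ) 0 0 = 1 := by simp [coe_T]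
    have t01 : (T : Matrix (Fin 2) (Fin 2) ℤ) 0 1 = 1 := by simp [coe_T]
    have t10 : (T : Matrix (Fin 2) (Fin 2) ℤ) 1 0 = 0 := by simp [coe_T]
    have t11 : (T : Matrix (Fin 2) (Fin 2) ℤ) 1 1 = 1 := by simp [coe_T]
    have hTi : ((T⁻¹ : SL(2, ℤ)) : Matrix (Fin 2) (Fin 2) ℤ) = !![1, -1; 0, 1] := coe_T_inv
    have i00 : ((T⁻¹ : SL(2, ℤ)) : Matrix (Fin 2) (Fin 2) ℤ) 0 0 = 1 := by rw [hTi]; simp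
    have i01 : ((T⁻¹ : SL(2, ℤ)) : Matrix (Fin 2) (Fin 2) ℤ) 0 1 = -1 := by rw [hTi]; simp
    have i10 : ((T⁻¹ : SL(2, ℤ)) : Matrix (Fin 2) (Fin 2) ℤ) 1 0 = 0 := by rw [hTi]; simp
    have i11 : ((T⁻¹ : SL(2, ℤ)) : Matrix (Fin 2) (Fin 2) ℤ) 1 1 = 1 := by rw [hTi]; simp
    have e00 : ((T * x * T⁻¹ : SL(2, ℤ)) 0 0 : ℤ) = 1 + p * (a + c) := by
      have : ((T * x * T⁻¹ : SL(2, ℤ)) 0 0 : ℤ) = x 0 0 + x 1 0 := by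
        simp only [Matrix.SpecialLinearGroup.coe_mul, Matrix.mul_apply, Fin.sum_univ_two, t00, t01, i00,
          i10, one_mul, mul_one, mul_zero, add_zero]
      rw [this, ha, hc]; ring
    have e01 : ((T * x * T⁻¹ : SL(2, ℤ)) 0 1 : ℤ) = p * (b + d - a - c) := by
      have : ((T * x * T⁻¹ : SL(2, ℤ)) 0 1 : ℤ) = -(x 0 0 + x 1 0) + (x 0 1 + x 1 1) := by
        simp only [Matrix.SpecialLinearGroup.coe_mul, Matrix.mul_apply, Fin.sum_univ_two, t00, t01, i01,
          i11, one_mul, mul_one, mul_neg]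
      rw [this, ha, hb, hc, hd]; ring
    have e10 : ((T * x * T⁻¹ : SL(2, ℤ)) 1 0 : ℤ) = p * c := by
      have : ((T * x * T⁻¹ : SL(2, ℤ)) 1 0 : ℤ) = x 1 0 := by
        simp only [Matrix.SpecialLinearGroup.coe_mul, Matrix.mul_apply, Fin.sum_univ_two, t10, t11, i00,
          i10, zero_mul, one_mul, zero_add, mul_one, mul_zero, add_zero]
      rw [this, hc]
    rw [P1 _ hTx _ _ _ e00 e01 e10]
    have hd' : (d : ZMod p) = -(a : ZMod p) := by
      have : d = -(p * (a * d - b * c)) - a := by linear_combination htr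
      rw [this]; push_cast; rw [hpp]; ring
    push_cast
    rw [hd']
    congr 1
    ext <;> ring
  -- (5) `T^p`
  have P5 : ∀ hT : T ^ p ∈ Gamma p, Φ ⟨T ^ p, hT⟩ = Multiplicative.ofAdd (0, 1, 0) := by
    intro hT
    have hTp : ((T ^ p : SL(2, ℤ)) : Matrix (Fin 2) (Fin 2) ℤ) = !![1, (p : ℤ); 0, 1] := by
      rw [show (T ^ p : SL(2, ℤ)) = T ^ (p : ℤ) from (zpow_natCast T p).symm]
      exact coe_T_zpow (p : ℤ)
    rw [P1 _ hT 0 1 0 (by simp [hTp]) (by simp [hTp]) (by simp [hTp])]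
    push_cast
    rfl
  -- (6) `S T^p S⁻¹`
  have P6 : ∀ hF' : S * T ^ p * S⁻¹ ∈ Gamma p,
      Φ ⟨S * T ^ p * S⁻¹, hF'⟩ = Multiplicative.ofAdd (0, 0, -1) := by
    intro hF'
    have hTp : ((T ^ p : SL(2, ℤ)) : Matrix (Fin 2) (Fin 2) ℤ) = !![1, (p : ℤ); 0, 1] := by
      rw [show (T ^ p : SL(2, ℤ)) = T ^ (p : ℤ) from (zpow_natCast T p).symm]
      exact coe_T_zpow (p : ℤ)
    have hSi : ((S⁻¹ : SL(2, ℤ)) : Matrix (Fin 2) (Fin 2) ℤ) = !![0, 1; -1, 0] := by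
      simp [Matrix.SpecialLinearGroup.coe_inv, coe_S, Matrix.adjugate_fin_two]
    have s00 : (S : Matrix (Fin 2) (Fin 2) ℤ) 0 0 = 0 := by simp [coe_S]
    have s01 : (S : Matrix (Fin 2) (Fin 2) ℤ) 0 1 = -1 := by simp [coe_S]
    have s10 : (S : Matrix (Fin 2) (Fin 2) ℤ) 1 0 = 1 := by simp [coe_S]
    have s11 : (S : Matrix (Fin 2) (Fin 2) ℤ) 1 1 = 0 := by simp [coe_S]
    have j00 : ((S⁻¹ : SL(2, ℤ)) : Matrix (Fin 2) (Fin 2) ℤ) 0 0 = 0 := by rw [hSi]; simp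
    have j01 : ((S⁻¹ : SL(2, ℤ)) : Matrix (Fin 2) (Fin 2) ℤ) 0 1 = 1 := by rw [hSi]; simp
    have j10 : ((S⁻¹ : SL(2, ℤ)) : Matrix (Fin 2) (Fin 2) ℤ) 1 0 = -1 := by rw [hSi]; simp
    have j11 : ((S⁻¹ : SL(2, ℤ)) : Matrix (Fin 2) (Fin 2) ℤ) 1 1 = 0 := by rw [hSi]; simp
    have u00 : ((T ^ p : SL(2, ℤ)) : Matrix (Fin 2) (Fin 2) ℤ) 0 0 = 1 := by rw [hTp]; simp
    have u01 : ((T ^ p : SL(2, ℤ)) : Matrix (Fin 2) (Fin 2) ℤ) 0 1 = p := by rw [hTp]; simp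
    have u10 : ((T ^ p : SL(2, ℤ)) : Matrix (Fin 2) (Fin 2) ℤ) 1 0 = 0 := by rw [hTp]; simp
    have u11 : ((T ^ p : SL(2, ℤ)) : Matrix (Fin 2) (Fin 2) ℤ) 1 1 = 1 := by rw [hTp]; simp
    have e00 : ((S * T ^ p * S⁻¹ : SL(2, ℤ)) 0 0 : ℤ) = 1 + p * 0 := by
      simp only [Matrix.SpecialLinearGroup.coe_mul, Matrix.mul_apply, Fin.sum_univ_two, s00, s01, u00,
        u01, u10, u11, j00, j10]
      ring
    have e01 : ((S * T ^ p * S⁻¹ : SL(2, ℤ)) 0 1 : ℤ) = p * 0 := by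
      simp only [Matrix.SpecialLinearGroup.coe_mul, Matrix.mul_apply, Fin.sum_univ_two, s00, s01, u00,
        u01, u10, u11, j01, j11]
      ring
    have e10 : ((S * T ^ p * S⁻¹ : SL(2, ℤ)) 1 0 : ℤ) = p * (-1) := by
      simp only [Matrix.SpecialLinearGroup.coe_mul, Matrix.mul_apply, Fin.sum_univ_two, s10, s11, u00,
        u01, u10, u11, j00, j10]
      ring
    rw [P1 _ hF' 0 0 (-1) e00 e01 e10]
    push_cast
    rfl
  -- (7) normal form
  have P7 : ∀ (uH uE uF : SL(2, ℤ)) (hH : uH ∈ Gamma p) (hE : uE ∈ Gamma p) (hF' : uF ∈ Gamma p),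
      Φ ⟨uH, hH⟩ = Multiplicative.ofAdd (-1, 1, -1) → Φ ⟨uE, hE⟩ = Multiplicative.ofAdd (0, 1, 0) →
      Φ ⟨uF, hF'⟩ = Multiplicative.ofAdd (0, 0, -1) →
      ∀ (x : SL(2, ℤ)), x ∈ Gamma p → ∃ i j k : ℤ, x * (uH ^ i * uE ^ j * uF ^ k)⁻¹ ∈ Gamma (p ^ 2) := by
    intro uH uE uF hH hE hF' h1 h2 h3 x hx
    obtain ⟨α, β, κ, δ, ha, hb, hc, hd⟩ := exists_entries_eq' hx
    refine ⟨-α, β + α, α - κ, ?_⟩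
    set UH : Gamma p := ⟨uH, hH⟩
    set UE : Gamma p := ⟨uE, hE⟩
    set UF : Gamma p := ⟨uF, hF'⟩
    set X : Gamma p := ⟨x, hx⟩
    have hval : Φ (X * (UH ^ (-α) * UE ^ (β + α) * UF ^ (α - κ))⁻¹) = 1 := by
      rw [map_mul, map_inv, map_mul, map_mul, map_zpow, map_zpow, map_zpow, h1, h2, h3,
        P1 x hx α β κ ha hb hc, mul_inv_eq_one]
      apply Multiplicative.toAdd.injective
      simp only [toAdd_ofAdd, toAdd_mul, toAdd_zpow, Prod.smul_mk, Prod.mk_add_mk, zsmul_eq_mul]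
      push_cast
      ext <;> ring
    have hmem := P3 _ (X * (UH ^ (-α) * UE ^ (β + α) * UF ^ (α - κ))⁻¹).2 hval
    simpa [X, UH, UE, UF] using hmem
  exact ⟨Φ, P1, P2, P3, P4, P5, P6, P7⟩

end UnboundedDenominators

end Literature.NumberTheory.Automorphic
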